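/-
Copyright (c) 2026 the pub-hodgecm-mathlib formalisation cell (harness21).  Prover seat hodgecm-mathlib-K2E3-p26 (g0), Track B «K2-LIT» ∕ h413
(`stmt-HodgeConjecture-24833`), line `K2_E3_EllipticInputs`, (SC-an)₂ road «FC₂» (in-house port of road «FC» to `U(1,1)`, dealer K2E3-plan (g4) deal D130,
assembly K2E3-p23 (g7) D132), brick (FC₂-8) file F1₂.  2026-09-04.
-/
import Literature.NumberTheory.Automorphic.UnitaryTwoCartanAnyInvolution          -- ★ `Two.exists_cartan_of_involution_two` (Cartan `U = K₀ a^ℕ K₀ Z(U)` in two variables, any involution), `Two.coe_pow_eq_two`,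
                                                                                  --   `Two.inv_apply_of_mem`, `Two.mem_glInt_iff_forall_v_le_one`, `Two.rel01`, `Two.exists_coe_eq_diag`, `Two.exists_coe_eq_weyl`, `Two.exists_diag_eq_glInt_mul_pow_mul_glInt`
import Literature.NumberTheory.Automorphic.HyperspecialUnitaryCompactOpen          -- ★ `HermitianLattice.unitaryInt`, `mem_unitaryInt_iff`; brings ★ `SymplecticCartan.exists_forall_v_le_exp_of_isCompact`
import HarnessLib

/-!
# Crux `H413` — K2-LIT E3, (SC-an)₂ road «FC₂» (finite conjugation measure on `U(1,1)`), brick (FC₂-8) file F1₂: THE `K₀ A K₀` ADAPTER ON `U = U(σ, Φ₂)(K)` —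
# `U = ⋃ₙ K₀ · tₙ · K₀` with `K₀ = U ∩ GL₂(𝒪)` and `tₙ = d(ϖ⁻ⁿ, (σϖ)ⁿ)`, the entries of `tₙ h tₙ⁻¹`, the smallness of `h₀₁` and the size of the diagonal

Cell `hodgecm-mathlib`, Track B, line `K2_E3_EllipticInputs`, PART «SC» socket (SC-an)₂ `sig_K2E3SupercuspidalTruncatedCharAnalyticTwo` via the in-house road «FC₂»
(dealer K2E3-plan (g4) D130∕D132; assembly `Theorems/K2E3FinConjAssemblyTwo.lean` of K2E3-p23 (g7) imports this file for its letters L1, L1″, L2); seat K2E3-p26 (g0).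
THEOREMS ONLY (no `def`, no `instance`, no notation, no named-fact hypothesis, no `sorry`); count-neutral helper (`--supports stmt-HodgeConjecture-24833 --as helper`).
The `Fin 2` twin of ★ `Theorems/K2E3FinConjCartanCover.lean` (K2E3-p23 (g4), N = 3), §§1–3 and the entry bound of §4; the generic boxes of its §4 are NOT repeated
(import that file), the unimodularity of `U(σ, Φ₂)(K)` is ★ `Theorems/K2E3HC14EllU11Haar.lean` §2 (NOT repeated), and the ray `∃ a, a = d(ϖ, (σϖ)⁻¹)` is ★
`UnitaryGroup.exists_coe_eq_diagonal_uniformizer_two` (NOT repeated).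

THE MATHEMATICS.  `K` a field with `Valued K ℤᵐ⁰` (+ `ValuativeRel`, compatible), `σ` an isometric involution, `J = Φ₂` (`(StdForm.antidiagonal 2).over K`),
`U = unitaryGroupOfForm σ J`, `K₀ = unitaryInt σ J = U ∩ GL₂(𝒪)`, `a = d(ϖ, (σϖ)⁻¹) ∈ U` the torus ray of ★ `UnitaryTwoCartanAnyInvolution` (`ϖ` a uniformiser).
Differences from N = 3: the ray has no middle entry, conjugation by `tₙ` scales the single upper entry `h₀₁` by `|ϖ|^{-2n}` (N = 3: `h₀₁, h₁₂` by `q^n`, `h₀₂` by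
`q^{2n}`), and `Z(U) ≤ K₀` needs no `2, 3 ≠ 0` (a central element commutes with the ray, hence is diagonal, and with the Weyl element, hence scalar).
* §1 `comap_glInt_eq_unitaryInt` — `(glInt 2 K).comap U.subtype = unitaryInt σ J`; `center_le_unitaryInt` — `Z(U) ≤ K₀`.
* §2 `coe_pow_eq_diagonal`, `coe_inv_pow_eq_diagonal` — `aⁿ = d(ϖⁿ, (σϖ)⁻ⁿ)`, `tₙ := (aⁿ)⁻¹ = d(ϖ⁻ⁿ, (σϖ)ⁿ)`; **`exists_mem_doubleCoset_inv_pow`** (letter L1 of the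
  assembly) — **`U = ⋃ₙ K₀ tₙ K₀`**.
* §3 `conj_inv_pow_apply`, `conj_inv_pow_apply_diag` — `(tₙ h tₙ⁻¹)ᵢⱼ = tᵢ hᵢⱼ tⱼ⁻¹`, diagonal unchanged; **`v_upper_le_of_conj_inv_pow`** (letter L1″) —
  `v((tₙhtₙ⁻¹)ᵢⱼ) ≤ exp M ⇒ v(h₀₁) ≤ exp(M − 2n)`; **`exp_neg_le_v_apply_diag`** (letter L2) — if moreover `M < n` then `exp(−M) ≤ v(h₀₀), v(h₁₁)` (the relation
  `σ(h₀₀)h₁₁ + σ(h₁₀)h₀₁ = 1` with `|σ(h₁₀)h₀₁| ≤ exp(2M − 2n) < 1` forces `|h₀₀|·|h₁₁| = 1`).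
* §4 `exists_forall_mem_v_apply_le_exp` — the entries of a compact subset of `U` are bounded by some `exp M`.

HONEST LABEL: HC_CM is proved only modulo the 7 printed citations (2 remaining named inputs: hLiu418 = stmt-HodgeConjecture-24832, h413 =
stmt-HodgeConjecture-24833) until rung 0 closes; local structure theory, closes no organ by itself ((SC-an)₂ is NOT ★; road «FC₂» pays it only when the assembly AND
every letter, including the (M5h₂) engine, are ★).

## References
* [BruhatTits1972] F. Bruhat, J. Tits, *Groupes réductifs sur un corps local I*, Publ. Math. IHÉS 41 (1972), (4.4.3) (`G = K A⁺ K`).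
* [Tits1979] J. Tits, *Reductive groups over local fields*, Proc. Sympos. Pure Math. 33.1 (1979), §3.2 (compact open stabilisers), §3.3.3 (Cartan decomposition).
* [Rogawski1990] J. D. Rogawski, *Automorphic Representations of Unitary Groups in Three Variables*, Ann. of Math. Stud. 123 (1990), §1.9–§1.10 pp. 8–9.
* [PlatonovRapinchuk1994] V. Platonov, A. Rapinchuk, *Algebraic Groups and Number Theory* (1994), §2.3 (centre of the unitary group), §3.3.
* [HarishChandra1970] Harish-Chandra (notes by G. van Dijk), *Harmonic Analysis on Reductive p-adic Groups*, LNM 162 (1970), Part V §3 (the integral over `K A K`).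
-/

set_option autoImplicit false
-- the mandated namespace repeats `HodgeConjecture.HodgeConjecture`, as in every `Theorems/*.lean` of this sub-problem
set_option linter.dupNamespace false

noncomputable section

open scoped MatrixGroups Pointwise Topology WithZero Valued
open Matrix Set

namespace Summit.HodgeConjecture.HodgeConjecture.Cruxes.H413.K2E3FinConjCartanCoverTwo

open Literature.NumberTheory.Automorphic Literature.NumberTheory.Automorphic.UnitaryGroup Literature.NumberTheory.Automorphic.HermitianLattice
open Literature.NumberTheory.Automorphic.SymplecticCartan

/-- Matrix of a product in `U`, entrywise (`2 × 2`). [folklore] -/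
private theorem coe_mul_apply {K : Type*} [Field K] {σ : K →+* K} {J : Matrix (Fin 2) (Fin 2) K} (g h : ↥(unitaryGroupOfForm σ J)) (i j : Fin 2) :
    (((g * h : ↥(unitaryGroupOfForm σ J)) : GL (Fin 2) K) : Matrix (Fin 2) (Fin 2) K) i j =
      ((g : GL (Fin 2) K) : Matrix (Fin 2) (Fin 2) K) i 0 * ((h : GL (Fin 2) K) : Matrix (Fin 2) (Fin 2) K) 0 j +
        ((g : GL (Fin 2) K) : Matrix (Fin 2) (Fin 2) K) i 1 * ((h : GL (Fin 2) K) : Matrix (Fin 2) (Fin 2) K) 1 j := by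
  rw [Subgroup.coe_mul, Units.val_mul, Matrix.mul_apply, Fin.sum_univ_two]

/-- In `ℤᵐ⁰`: `x · x = 1 ⇒ x = 1`. [folklore] -/
private theorem eq_one_of_mul_self_eq_one {x : ℤᵐ⁰} (h : x * x = 1) : x = 1 := by
  rcases lt_trichotomy x 1 with hlt | heq | hgt
  · exfalso
    have hx0 : x ≠ 0 := fun h0 => by rw [h0, mul_zero] at h; exact zero_ne_one h
    have : x * x < 1 :=
      calc x * x < x * 1 := mul_lt_mul_of_pos_left hlt (zero_lt_iff.2 hx0)
        _ ≤ 1 * 1 := mul_le_mul' hlt.le le_rfl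
        _ = 1 := mul_one 1
    rw [h] at this; exact lt_irrefl _ this
  · exact heq
  · exfalso
    have : 1 < x * x :=
      calc (1 : ℤᵐ⁰) = 1 * 1 := (mul_one 1).symm
        _ < x * 1 := mul_lt_mul_of_pos_right hgt zero_lt_one
        _ ≤ x * x := mul_le_mul' le_rfl hgt.le
    rw [h] at this; exact lt_irrefl _ this

/-! ## §1 `K₀ = U ∩ GL₂(𝒪)`: the two spellings agree; the centre is inside -/

section KZero

variable {K : Type*} [Field K] [Valued K ℤᵐ⁰] [ValuativeRel K] [(Valued.v : Valuation K ℤᵐ⁰).Compatible]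
  (σ : K →+* K) {J : Matrix (Fin 2) (Fin 2) K} (hJ : J = (StdForm.antidiagonal 2).over K) {ϖ : K}

include hJ in
/-- **The `K₀` of ★ `Two.exists_cartan_of_involution_two` is `unitaryInt σ J`**: `(glInt 2 K).comap U.subtype = U ∩ GL₂(𝒪)` (for `g ∈ U(σ,Φ₂)` the inverse is
`Φ₂ σ(g)ᵀ Φ₂`, so integrality of `g` gives that of `g⁻¹`, ★ `Two.inv_apply_of_mem`). [cite: PlatonovRapinchuk1994, §3.3] [cite: Tits1979, §3.2] -/
theorem comap_glInt_eq_unitaryInt (hσv : ∀ x, Valued.v (σ x) = Valued.v x) :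
    (glInt 2 K).comap (unitaryGroupOfForm σ J).subtype = unitaryInt σ J := by
  ext g
  rw [Subgroup.mem_comap, Subgroup.coe_subtype, Two.mem_glInt_iff_forall_v_le_one σ hJ hσv g, mem_unitaryInt_iff]
  constructor
  · intro h
    refine ⟨h, fun i j => ?_⟩
    rw [Two.inv_apply_of_mem σ hJ g i j, hσv]
    exact h _ _
  · exact fun h => h.1

include hJ in
/-- **`Z(U) ≤ K₀`** in two variables, for ANY isometric involution `σ` and any uniformiser `ϖ` (no `2 ≠ 0` needed): a central `z` commutes with the ray `a = d(ϖ, (σϖ)⁻¹)`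
(★ `Two.exists_coe_eq_diag`; `ϖ ≠ (σϖ)⁻¹` as `|ϖ| = exp(−1) ≠ exp 1`), hence is diagonal; it commutes with the Weyl element `w₀` (★ `Two.exists_coe_eq_weyl`), hence is a scalar
`γ·1`; the `(0,1)` relation `σ(γ)γ = 1` (★ `Two.rel01`) gives `|γ|² = 1`, so `|γ| = 1` and `z ∈ U ∩ GL₂(𝒪)`. [cite: PlatonovRapinchuk1994, §2.3] [cite: Rogawski1990, §1.10 p. 9] -/
theorem center_le_unitaryInt (hσ : ∀ x, σ (σ x) = x) (hσv : ∀ x, Valued.v (σ x) = Valued.v x) (hϖ : Valued.v ϖ = WithZero.exp (-1 : ℤ)) :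
    Subgroup.center ↥(unitaryGroupOfForm σ J) ≤ unitaryInt σ J := by
  intro z hz
  have hϖ0 : ϖ ≠ 0 := fun h => by rw [h, map_zero] at hϖ; exact WithZero.zero_ne_coe hϖ
  have hσϖ0 : σ ϖ ≠ 0 := (map_ne_zero σ).2 hϖ0
  -- the ray and the Weyl element
  obtain ⟨a, ha⟩ := Two.exists_coe_eq_diag σ hJ hσ (p := ϖ) (s := (σ ϖ)⁻¹) (mul_inv_cancel₀ hσϖ0)
  obtain ⟨w, hw⟩ := Two.exists_coe_eq_weyl σ hJ
  have hne : (σ ϖ)⁻¹ - ϖ ≠ 0 := by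
    intro h
    have h' : Valued.v ((σ ϖ)⁻¹) = Valued.v ϖ := by rw [sub_eq_zero.1 h]
    rw [map_inv₀, hσv, hϖ, ← WithZero.exp_neg, neg_neg] at h'
    have := WithZero.exp_injective h'
    omega
  set Z : Matrix (Fin 2) (Fin 2) K := ((z : GL (Fin 2) K) : Matrix (Fin 2) (Fin 2) K) with hZ
  -- `z` commutes with `a`: off-diagonal entries vanish
  have hza : a * z = z * a := Subgroup.mem_center_iff.1 hz a
  have h01 : Z 0 1 = 0 := by
    have h := congrArg (fun x : ↥(unitaryGroupOfForm σ J) => ((x : GL (Fin 2) K) : Matrix (Fin 2) (Fin 2) K) 0 1) hza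
    simp only [coe_mul_apply, ha, Matrix.of_apply, Matrix.cons_val', Matrix.cons_val_zero, Matrix.cons_val_one, Matrix.cons_val_fin_one,
      zero_mul, add_zero, mul_zero, zero_add] at h
    -- `h : ϖ * Z 0 1 = Z 0 1 * (σ ϖ)⁻¹`
    have : Z 0 1 * ((σ ϖ)⁻¹ - ϖ) = 0 := by rw [mul_sub, ← h]; ring
    exact (mul_eq_zero.1 this).resolve_right hne
  have h10 : Z 1 0 = 0 := by
    have h := congrArg (fun x : ↥(unitaryGroupOfForm σ J) => ((x : GL (Fin 2) K) : Matrix (Fin 2) (Fin 2) K) 1 0) hza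
    simp only [coe_mul_apply, ha, Matrix.of_apply, Matrix.cons_val', Matrix.cons_val_zero, Matrix.cons_val_one, Matrix.cons_val_fin_one,
      zero_mul, add_zero, mul_zero, zero_add] at h
    -- `h : (σ ϖ)⁻¹ * Z 1 0 = Z 1 0 * ϖ`
    have : Z 1 0 * ((σ ϖ)⁻¹ - ϖ) = 0 := by rw [mul_sub, mul_comm (Z 1 0) ((σ ϖ)⁻¹), h]; ring
    exact (mul_eq_zero.1 this).resolve_right hne
  -- `z` commutes with `w₀`: the diagonal entries agree
  have hzw : w * z = z * w := Subgroup.mem_center_iff.1 hz w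
  have h00 : Z 0 0 = Z 1 1 := by
    have h := congrArg (fun x : ↥(unitaryGroupOfForm σ J) => ((x : GL (Fin 2) K) : Matrix (Fin 2) (Fin 2) K) 0 1) hzw
    simp only [coe_mul_apply, hw, Matrix.of_apply, Matrix.cons_val', Matrix.cons_val_zero, Matrix.cons_val_one, Matrix.cons_val_fin_one,
      zero_mul, one_mul, mul_zero, mul_one, zero_add, add_zero] at h
    -- `h : Z 1 1 = Z 0 0`
    exact h.symm
  -- the `(0,1)` relation: `σ(Z₀₀) Z₁₁ = 1`, so `|Z₀₀| = 1`
  have hrel := Two.rel01 σ hJ z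
  rw [← hZ] at hrel
  rw [h10, map_zero, zero_mul, add_zero, ← h00] at hrel
  have hv : Valued.v (Z 0 0) = 1 := by
    apply eq_one_of_mul_self_eq_one
    have := congrArg Valued.v hrel
    rwa [map_mul, hσv, map_one] at this
  -- so `z ∈ GL₂(𝒪)`
  rw [← comap_glInt_eq_unitaryInt σ hJ hσv, Subgroup.mem_comap, Subgroup.coe_subtype, Two.mem_glInt_iff_forall_v_le_one σ hJ hσv]
  intro i j
  rw [← hZ]
  fin_cases i <;> fin_cases j
  · exact hv.le
  · simp only [Fin.zero_eta, Fin.mk_one, h01, map_zero]; exact zero_le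
  · simp only [Fin.zero_eta, Fin.mk_one, h10, map_zero]; exact zero_le
  · simp only [Fin.mk_one, ← h00]; exact hv.le

end KZero

/-! ## §2 The ray `aⁿ = d(ϖⁿ, (σϖ)⁻ⁿ)`, the inverse ray `tₙ = (aⁿ)⁻¹ = d(ϖ⁻ⁿ, (σϖ)ⁿ)` and the cover `U = ⋃ₙ K₀ tₙ K₀` -/

section Ray

variable {K : Type*} [Field K] [Valued K ℤᵐ⁰] [ValuativeRel K] [(Valued.v : Valuation K ℤᵐ⁰).Compatible]
  (σ : K →+* K) {J : Matrix (Fin 2) (Fin 2) K} (hJ : J = (StdForm.antidiagonal 2).over K) {ϖ : K}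

omit [Valued K ℤᵐ⁰] [ValuativeRel K] [(Valued.v : Valuation K ℤᵐ⁰).Compatible] in
/-- **`aⁿ` has matrix `d(ϖⁿ, (σϖ)⁻ⁿ)`** (★ `Two.coe_pow_eq_two`, respelled with `Matrix.diagonal`). [cite: Rogawski1990, §1.10 p. 9] -/
theorem coe_pow_eq_diagonal (a : ↥(unitaryGroupOfForm σ J)) (ha : ((a : GL (Fin 2) K) : Matrix (Fin 2) (Fin 2) K) = Matrix.diagonal ![ϖ, (σ ϖ)⁻¹]) (n : ℕ) :
    (((a ^ n : ↥(unitaryGroupOfForm σ J)) : GL (Fin 2) K) : Matrix (Fin 2) (Fin 2) K) = Matrix.diagonal ![ϖ ^ n, (σ ϖ)⁻¹ ^ n] := by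
  rw [Two.coe_pow_eq_two σ a ha n]
  ext i j; fin_cases i <;> fin_cases j <;> simp

include hJ in
omit [Valued K ℤᵐ⁰] [ValuativeRel K] [(Valued.v : Valuation K ℤᵐ⁰).Compatible] in
/-- **`tₙ = (aⁿ)⁻¹` has matrix `d(ϖ⁻ⁿ, (σϖ)ⁿ)`** (★ `Two.coe_pow_eq_two` + ★ `Two.inv_apply_of_mem`: the inverse in `U(σ,Φ₂)` is `σ` of the `rev`-transpose; `σ` an involution).
[cite: Rogawski1990, §1.10 p. 9] -/
theorem coe_inv_pow_eq_diagonal (hσ : ∀ x, σ (σ x) = x) (a : ↥(unitaryGroupOfForm σ J))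
    (ha : ((a : GL (Fin 2) K) : Matrix (Fin 2) (Fin 2) K) = Matrix.diagonal ![ϖ, (σ ϖ)⁻¹]) (n : ℕ) :
    ((((a ^ n)⁻¹ : ↥(unitaryGroupOfForm σ J)) : GL (Fin 2) K) : Matrix (Fin 2) (Fin 2) K) = Matrix.diagonal ![ϖ⁻¹ ^ n, (σ ϖ) ^ n] := by
  ext i j
  rw [Subgroup.coe_inv, Two.inv_apply_of_mem σ hJ (a ^ n) i j, Two.coe_pow_eq_two σ a ha n]
  fin_cases i <;> fin_cases j <;> simp [Fin.rev, map_pow, hσ]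

include hJ in
/-- **THE COVER `U = ⋃ₙ K₀ · tₙ · K₀`** (letter L1 of the (FC₂-8) assembly), `tₙ = (aⁿ)⁻¹`, `K₀ = unitaryInt σ J`: every `g ∈ U(σ, Φ₂)(K)` lies in `K₀ (aⁿ)⁻¹ K₀` for some
`n : ℕ` (★ Cartan `g = k₁ aᵐ k₂ z` of `Two.exists_cartan_of_involution_two`, the centre is in `K₀` by `center_le_unitaryInt`, and `aᵐ ∈ K₀ (aⁿ)⁻¹ K₀` for some `n`: the diagonal
`(aᵐ)⁻¹` is `k₃ aⁿ k₄` by ★ `Two.exists_diag_eq_glInt_mul_pow_mul_glInt`; `σ` an isometric involution, `ϖ` ANY uniformiser — ramified and residue characteristic `2` included).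
[cite: BruhatTits1972, (4.4.3)] [cite: Tits1979, §3.3.3] -/
theorem exists_mem_doubleCoset_inv_pow (hσ : ∀ x, σ (σ x) = x) (hσv : ∀ x, Valued.v (σ x) = Valued.v x)
    (hϖ : Valued.v ϖ = WithZero.exp (-1 : ℤ))
    (a : ↥(unitaryGroupOfForm σ J)) (ha : ((a : GL (Fin 2) K) : Matrix (Fin 2) (Fin 2) K) = Matrix.diagonal ![ϖ, (σ ϖ)⁻¹])
    (g : ↥(unitaryGroupOfForm σ J)) :
    ∃ n : ℕ, g ∈ (unitaryInt σ J : Set ↥(unitaryGroupOfForm σ J)) * {(a ^ n)⁻¹} * (unitaryInt σ J : Set ↥(unitaryGroupOfForm σ J)) := by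
  obtain ⟨k₁, hk₁, k₂, hk₂, m, z, hz, hg⟩ := Two.exists_cartan_of_involution_two σ hJ hσ hσv hϖ a ha g
  -- the diagonal `(aᵐ)⁻¹` is `k₃ aⁿ k₄`
  have ht10 : ((((a ^ m)⁻¹ : ↥(unitaryGroupOfForm σ J)) : GL (Fin 2) K) : Matrix (Fin 2) (Fin 2) K) 1 0 = 0 := by
    rw [coe_inv_pow_eq_diagonal σ hJ hσ a ha m]; simp
  have ht01 : ((((a ^ m)⁻¹ : ↥(unitaryGroupOfForm σ J)) : GL (Fin 2) K) : Matrix (Fin 2) (Fin 2) K) 0 1 = 0 := by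
    rw [coe_inv_pow_eq_diagonal σ hJ hσ a ha m]; simp
  obtain ⟨k₃, hk₃, k₄, hk₄, n, hinv⟩ := Two.exists_diag_eq_glInt_mul_pow_mul_glInt σ hJ hσ hσv hϖ a ha (a ^ m)⁻¹ ht10 ht01
  rw [comap_glInt_eq_unitaryInt σ hJ hσv] at hk₁ hk₂ hk₃ hk₄
  have hzK : z ∈ unitaryInt σ J := center_le_unitaryInt σ hJ hσ hσv hϖ hz
  -- `aᵐ = k₄⁻¹ (aⁿ)⁻¹ k₃⁻¹`
  have hpow : a ^ m = k₄⁻¹ * (a ^ n)⁻¹ * k₃⁻¹ := by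
    have : (a ^ m)⁻¹⁻¹ = (k₃ * a ^ n * k₄)⁻¹ := by rw [hinv]
    rw [inv_inv, _root_.mul_inv_rev, _root_.mul_inv_rev, ← mul_assoc] at this
    exact this
  refine ⟨n, Set.mem_mul.2 ⟨k₁ * k₄⁻¹ * (a ^ n)⁻¹, Set.mem_mul.2 ⟨k₁ * k₄⁻¹, (unitaryInt σ J).mul_mem hk₁ ((unitaryInt σ J).inv_mem hk₄), (a ^ n)⁻¹,
    Set.mem_singleton _, rfl⟩, k₃⁻¹ * k₂ * z, (unitaryInt σ J).mul_mem ((unitaryInt σ J).mul_mem ((unitaryInt σ J).inv_mem hk₃) hk₂) hzK, ?_⟩⟩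
  symm
  calc g = k₁ * a ^ m * k₂ * z := hg
    _ = k₁ * (k₄⁻¹ * (a ^ n)⁻¹ * k₃⁻¹) * k₂ * z := by rw [← hpow]
    _ = k₁ * k₄⁻¹ * (a ^ n)⁻¹ * (k₃⁻¹ * k₂ * z) := by simp only [mul_assoc]

end Ray

/-! ## §3 Conjugation by `tₙ`: entries, diagonal, the smallness of `h₀₁`, and the size of the diagonal -/

section Conj

variable {K : Type*} [Field K] [Valued K ℤᵐ⁰] [ValuativeRel K] [(Valued.v : Valuation K ℤᵐ⁰).Compatible]
  (σ : K →+* K) {J : Matrix (Fin 2) (Fin 2) K} (hJ : J = (StdForm.antidiagonal 2).over K) {ϖ : K}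

include hJ in
omit [Valued K ℤᵐ⁰] [ValuativeRel K] [(Valued.v : Valuation K ℤᵐ⁰).Compatible] in
/-- **`(tₙ h tₙ⁻¹)ᵢⱼ = tᵢ · hᵢⱼ · tⱼ⁻¹`** with `t = d(ϖ⁻ⁿ, (σϖ)ⁿ)`, `t⁻¹ = aⁿ = d(ϖⁿ, (σϖ)⁻ⁿ)`. [cite: Rogawski1990, §1.10 p. 9] -/
theorem conj_inv_pow_apply (hσ : ∀ x, σ (σ x) = x) (a : ↥(unitaryGroupOfForm σ J))
    (ha : ((a : GL (Fin 2) K) : Matrix (Fin 2) (Fin 2) K) = Matrix.diagonal ![ϖ, (σ ϖ)⁻¹]) (n : ℕ) (h : ↥(unitaryGroupOfForm σ J)) (i j : Fin 2) :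
    ((((a ^ n)⁻¹ * h * a ^ n : ↥(unitaryGroupOfForm σ J)) : GL (Fin 2) K) : Matrix (Fin 2) (Fin 2) K) i j =
      ![ϖ⁻¹ ^ n, (σ ϖ) ^ n] i * ((h : GL (Fin 2) K) : Matrix (Fin 2) (Fin 2) K) i j * ![ϖ ^ n, (σ ϖ)⁻¹ ^ n] j := by
  rw [Subgroup.coe_mul, Subgroup.coe_mul, Units.val_mul, Units.val_mul, coe_inv_pow_eq_diagonal σ hJ hσ a ha n, coe_pow_eq_diagonal σ a ha n,
    Matrix.mul_diagonal, Matrix.diagonal_mul]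

include hJ in
omit [Valued K ℤᵐ⁰] [ValuativeRel K] [(Valued.v : Valuation K ℤᵐ⁰).Compatible] in
/-- **The diagonal of `tₙ h tₙ⁻¹` is the diagonal of `h`** (`ϖ ≠ 0`). [cite: Rogawski1990, §1.10 p. 9] -/
theorem conj_inv_pow_apply_diag (hσ : ∀ x, σ (σ x) = x) (hϖ0 : ϖ ≠ 0) (a : ↥(unitaryGroupOfForm σ J))
    (ha : ((a : GL (Fin 2) K) : Matrix (Fin 2) (Fin 2) K) = Matrix.diagonal ![ϖ, (σ ϖ)⁻¹]) (n : ℕ) (h : ↥(unitaryGroupOfForm σ J)) (i : Fin 2) :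
    ((((a ^ n)⁻¹ * h * a ^ n : ↥(unitaryGroupOfForm σ J)) : GL (Fin 2) K) : Matrix (Fin 2) (Fin 2) K) i i =
      ((h : GL (Fin 2) K) : Matrix (Fin 2) (Fin 2) K) i i := by
  have hσϖ0 : σ ϖ ≠ 0 := (map_ne_zero σ).2 hϖ0
  rw [conj_inv_pow_apply σ hJ hσ a ha n h i i]
  fin_cases i
  · simp only [Fin.zero_eta, Matrix.cons_val_zero]
    rw [mul_comm, ← mul_assoc, ← mul_pow, mul_inv_cancel₀ hϖ0, one_pow, one_mul]
  · simp only [Fin.mk_one, Matrix.cons_val_one, Matrix.cons_val_fin_one]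
    rw [mul_comm, ← mul_assoc, ← mul_pow, inv_mul_cancel₀ hσϖ0, one_pow, one_mul]

include hJ in
omit [ValuativeRel K] [(Valued.v : Valuation K ℤᵐ⁰).Compatible] in
/-- **SMALL UPPER ENTRY** (letter L1″ of the (FC₂-8) assembly): if every entry of `tₙ h tₙ⁻¹` has valuation `≤ exp M` then `v(h₀₁) ≤ exp(M − 2n)` (`σ` an isometric involution, `ϖ` a
uniformiser; `(tₙ h tₙ⁻¹)₀₁ = ϖ⁻ⁿ h₀₁ (σϖ)⁻ⁿ`). [cite: HarishChandra1970, Part V §3] [cite: Rogawski1990, §1.10 p. 9] -/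
theorem v_upper_le_of_conj_inv_pow (hσ : ∀ x, σ (σ x) = x) (hσv : ∀ x, Valued.v (σ x) = Valued.v x) (hϖ : Valued.v ϖ = WithZero.exp (-1 : ℤ))
    (a : ↥(unitaryGroupOfForm σ J)) (ha : ((a : GL (Fin 2) K) : Matrix (Fin 2) (Fin 2) K) = Matrix.diagonal ![ϖ, (σ ϖ)⁻¹]) (n M : ℕ)
    (h : ↥(unitaryGroupOfForm σ J))
    (hb : ∀ i j, Valued.v (((((a ^ n)⁻¹ * h * a ^ n : ↥(unitaryGroupOfForm σ J)) : GL (Fin 2) K) : Matrix (Fin 2) (Fin 2) K) i j) ≤ WithZero.exp (M : ℤ)) :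
    Valued.v (((h : GL (Fin 2) K) : Matrix (Fin 2) (Fin 2) K) 0 1) ≤ WithZero.exp ((M : ℤ) - 2 * n) := by
  have hvinv : Valued.v (ϖ⁻¹ ^ n) = WithZero.exp (n : ℤ) := by
    rw [map_pow, map_inv₀, hϖ, ← WithZero.exp_neg, neg_neg, ← WithZero.exp_nsmul, nsmul_eq_mul, mul_one]
  have hvσ : Valued.v ((σ ϖ)⁻¹ ^ n) = WithZero.exp (n : ℤ) := by
    rw [map_pow, map_inv₀, hσv, hϖ, ← WithZero.exp_neg, neg_neg, ← WithZero.exp_nsmul, nsmul_eq_mul, mul_one]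
  -- generic step: `exp e * v x ≤ exp M ⇒ v x ≤ exp (M - e)`
  have key : ∀ (x : K) (e : ℤ), WithZero.exp e * Valued.v x ≤ WithZero.exp (M : ℤ) → Valued.v x ≤ WithZero.exp ((M : ℤ) - e) := by
    intro x e hx
    calc Valued.v x = WithZero.exp (-e) * (WithZero.exp e * Valued.v x) := by
          rw [← mul_assoc, ← WithZero.exp_add, neg_add_cancel, WithZero.exp_zero, one_mul]
      _ ≤ WithZero.exp (-e) * WithZero.exp (M : ℤ) := mul_le_mul' le_rfl hx
      _ = WithZero.exp ((M : ℤ) - e) := by rw [← WithZero.exp_add, neg_add_eq_sub]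
  have h01 := hb 0 1
  rw [conj_inv_pow_apply σ hJ hσ a ha n h] at h01
  simp only [Fin.isValue, Matrix.cons_val_zero, Matrix.cons_val_one, Matrix.cons_val_fin_one, map_mul, hvinv, hvσ] at h01
  rw [mul_right_comm, ← WithZero.exp_add, ← two_mul] at h01
  exact key _ _ h01

include hJ in
omit [ValuativeRel K] [(Valued.v : Valuation K ℤᵐ⁰).Compatible] in
/-- **THE DIAGONAL IS LARGE WHEN THE UPPER ENTRY IS SMALL** (letter L2 of the (FC₂-8) assembly): if `v(hᵢⱼ) ≤ exp M` for all `i j`, `v(h₀₁) ≤ exp(M − 2n)` and `M < n`, then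
`exp(−M) ≤ v(h₀₀)` and `exp(−M) ≤ v(h₁₁)`: the `(0,1)` unitarity relation `σ(h₀₀) h₁₁ + σ(h₁₀) h₀₁ = 1` (★ `Two.rel01`) has second term of valuation `≤ exp(2M − 2n) < 1`, so
`|σ(h₀₀) h₁₁| = 1`, i.e. `|h₀₀|·|h₁₁| = 1` (`σ` isometric), and each factor is `≤ exp M`. [cite: HarishChandra1970, Part V §3] [cite: Rogawski1990, §1.9 p. 8] -/
theorem exp_neg_le_v_apply_diag (hσv : ∀ x, Valued.v (σ x) = Valued.v x) (M n : ℕ) (hMn : M < n) (h : ↥(unitaryGroupOfForm σ J))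
    (hb : ∀ i j, Valued.v (((h : GL (Fin 2) K) : Matrix (Fin 2) (Fin 2) K) i j) ≤ WithZero.exp (M : ℤ))
    (h01 : Valued.v (((h : GL (Fin 2) K) : Matrix (Fin 2) (Fin 2) K) 0 1) ≤ WithZero.exp ((M : ℤ) - 2 * n)) (i : Fin 2) :
    WithZero.exp (-(M : ℤ)) ≤ Valued.v (((h : GL (Fin 2) K) : Matrix (Fin 2) (Fin 2) K) i i) := by
  set H : Matrix (Fin 2) (Fin 2) K := ((h : GL (Fin 2) K) : Matrix (Fin 2) (Fin 2) K) with hH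
  have hrel := Two.rel01 σ hJ h
  rw [← hH] at hrel
  -- the second term is small
  have hsmall : Valued.v (σ (H 1 0) * H 0 1) < 1 := by
    rw [map_mul, hσv]
    calc Valued.v (H 1 0) * Valued.v (H 0 1) ≤ WithZero.exp (M : ℤ) * WithZero.exp ((M : ℤ) - 2 * n) := mul_le_mul' (hb 1 0) h01
      _ = WithZero.exp ((M : ℤ) + ((M : ℤ) - 2 * n)) := (WithZero.exp_add _ _).symm
      _ < WithZero.exp 0 := WithZero.exp_lt_exp.2 (by omega)
      _ = 1 := WithZero.exp_zero
  -- hence the first term has valuation `1`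
  have hone : Valued.v (σ (H 0 0) * H 1 1) = 1 := by
    have heq : σ (H 0 0) * H 1 1 = 1 - σ (H 1 0) * H 0 1 := eq_sub_of_add_eq hrel
    rw [heq]
    rw [Valuation.map_one_sub_of_lt _ hsmall]
  rw [map_mul, hσv] at hone
  -- `v(H 0 0) * v(H 1 1) = 1` with both factors `≤ exp M`
  have hle : ∀ {x y : ℤᵐ⁰}, x * y = 1 → y ≤ WithZero.exp (M : ℤ) → WithZero.exp (-(M : ℤ)) ≤ x := by
    intro x y hxy hy
    have hy0 : y ≠ 0 := fun h0 => by rw [h0, mul_zero] at hxy; exact zero_ne_one hxy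
    rw [eq_inv_of_mul_eq_one_left hxy, WithZero.exp_neg]
    exact inv_anti₀ (zero_lt_iff.2 hy0) hy
  fin_cases i
  · exact hle hone (hb 1 1)
  · rw [mul_comm] at hone
    exact hle hone (hb 0 0)

end Conj

/-! ## §4 The entry bound on a compact subset of `U` -/

section Entries

variable {K : Type*} [Field K] [Valued K ℤᵐ⁰] (σ : K →+* K) (J : Matrix (Fin 2) (Fin 2) K) {ϖ : K}

/-- **The entries of a compact subset of `U(σ, J)` (`2 × 2`) are bounded**: `∃ M, ∀ g ∈ Ω, ∀ i j, v(gᵢⱼ) ≤ exp M` (each entry is continuous; ★ `exists_forall_v_le_exp_of_isCompact`;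
the maximum over the four entries). [cite: Tits1979, §3.2] -/
theorem exists_forall_mem_v_apply_le_exp (hϖ : Valued.v ϖ = WithZero.exp (-1 : ℤ)) {Ω : Set ↥(unitaryGroupOfForm σ J)} (hΩ : IsCompact Ω) :
    ∃ M : ℕ, ∀ g ∈ Ω, ∀ i j, Valued.v (((g : GL (Fin 2) K) : Matrix (Fin 2) (Fin 2) K) i j) ≤ WithZero.exp (M : ℤ) := by
  have hcont : ∀ i j : Fin 2, Continuous fun g : ↥(unitaryGroupOfForm σ J) => ((g : GL (Fin 2) K) : Matrix (Fin 2) (Fin 2) K) i j :=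
    fun i j => (Units.continuous_val.comp continuous_subtype_val).matrix_elem i j
  choose M hM using fun ij : Fin 2 × Fin 2 => exists_forall_v_le_exp_of_isCompact hϖ (hΩ.image (hcont ij.1 ij.2))
  refine ⟨Finset.univ.sup M, fun g hg i j => ?_⟩
  refine (hM (i, j) _ ⟨g, hg, rfl⟩).trans (WithZero.exp_le_exp.2 ?_)
  exact_mod_cast Finset.le_sup (f := M) (Finset.mem_univ (i, j))

end Entries

end Summit.HodgeConjecture.HodgeConjecture.Cruxes.H413.K2E3FinConjCartanCoverTwo

end
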